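import Mathlib.Topology.MetricSpace.Pseudo.Defs
import Mathlib.Topology.Algebra.Ring.Real
import Mathlib.Topology.Order.OrderClosed
import Mathlib.Topology.Constructions.SumProd
import Literature.Dynamics.TopologicalDynamics.UniformRecurrence
import HarnessLib

/-!
# Crux `RecurrentLiouville` (stmt-NavierStokesRegularity-1589), line `Ideator5Round2Sketch` — stub `stub_constOfTendstoOfRecurrent`:
# convergent + recurrent ⇒ constant

Theorems-only file (no definitions, no named facts), pure topological dynamics in the vocabulary of
Furstenberg 1981, Ch. 1 §4 (`Literature.Dynamics.TopologicalDynamics.IsUniformlyRecurrentPt`,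
`IsSyndetic`).  For a jointly continuous `ℝ`-action `ϕ` on a topological space `X` with the action law
`ϕ (s + t) = ϕ s ∘ ϕ t`, a continuous observable `φ : X → ℝ`, and a UNIFORMLY RECURRENT point `x`:
if `φ (ϕ s x) → c` as `s → +∞`, then `φ (ϕ s x) = c` for every `s : ℝ`
(`const_of_tendsto_of_isUniformlyRecurrentPt`, registered stub `stub_constOfTendstoOfRecurrent`).

Proof: if `φ (ϕ s₀ x) ≠ c`, put `ε = |φ (ϕ s₀ x) − c| / 2 > 0`.  By joint continuity the set
`U = {y | ε < |φ (ϕ s₀ y) − c|}` is an open neighbourhood of `x`, so the return times of `x` to `U`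
are syndetic, i.e. (`isSyndetic_iff_exists_window`) every window `[a, a + L]` contains one.  Choose
`N` with `|φ (ϕ s x) − c| < ε` for `s ≥ N` and a return time `t ∈ [N − s₀, N − s₀ + L]`; then
`ε < |φ (ϕ s₀ (ϕ t x)) − c| = |φ (ϕ (s₀ + t) x) − c| < ε`, a contradiction.  Neither `ϕ 0 = id`
nor compactness is used.

## References

* H. Furstenberg, *Recurrence in Ergodic Theory and Combinatorial Number Theory*, Princeton UP
  (1981), Ch. 1 §4, Def. 1.7 (syndetic), Def. 1.8 (uniformly recurrent). [folklore]
-/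

noncomputable section

-- the sub-problem namespace repeats the summit name (D-0017 layout `Summit.<S>.<P>.Theorems`)
set_option linter.dupNamespace false

namespace Summit.NavierStokesRegularity.NavierStokesRegularity.Theorems

open Set Function Filter Topology
open Literature.Dynamics.TopologicalDynamics

/-- **Convergent + recurrent ⇒ constant.**  For a jointly continuous `ℝ`-action `ϕ` with the action
law `ϕ (s + t) = ϕ s ∘ ϕ t`, a continuous observable `φ`, and a uniformly recurrent point `x`, if
`φ (ϕ s x) → c` as `s → +∞` then `φ (ϕ s₀ x) = c` for every `s₀ : ℝ`: otherwise joint continuity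
gives an open neighbourhood `U ∋ x` on which `|φ (ϕ s₀ ·) − c| > ε`, the return times of `x` to `U`
are syndetic, hence meet `[N − s₀, ∞)` for the convergence threshold `N`, and the action law turns
such a return time `t` into the time `s₀ + t ≥ N` at which `φ (ϕ · x)` is both `ε`-far from and
`ε`-close to `c`. [folklore; cite: Furstenberg1981, Ch. 1 §4, Def. 1.7–1.8 for the notions] -/
theorem const_of_tendsto_of_isUniformlyRecurrentPt {X : Type*} [TopologicalSpace X]
    {ϕ : ℝ → X → X} (hcont : Continuous fun p : ℝ × X => ϕ p.1 p.2)
    (hadd : ∀ s t y, ϕ (s + t) y = ϕ s (ϕ t y)) {φ : X → ℝ} (hφ : Continuous φ) {x : X}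
    (hx : IsUniformlyRecurrentPt ϕ x) {c : ℝ} (hc : Tendsto (fun s => φ (ϕ s x)) atTop (𝓝 c))
    (s₀ : ℝ) : φ (ϕ s₀ x) = c := by
  by_contra hne
  -- the separation `ε`
  set ε : ℝ := |φ (ϕ s₀ x) - c| / 2 with hε_def
  have habs : 0 < |φ (ϕ s₀ x) - c| := abs_pos.2 (sub_ne_zero.2 hne)
  have hε : 0 < ε := by positivity
  -- the time-`s₀` map followed by the observable is continuous (joint continuity)
  have hcs : Continuous fun y => φ (ϕ s₀ y) :=
    hφ.comp (hcont.comp (Continuous.prodMk_right s₀))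
  -- the open neighbourhood `U` of `x` on which `φ ∘ ϕ s₀` stays `ε`-away from `c`
  set U : Set X := {y | ε < |φ (ϕ s₀ y) - c|}
  have hUo : IsOpen U := isOpen_lt continuous_const (hcs.sub continuous_const).abs
  have hxU : x ∈ U := by
    show ε < |φ (ϕ s₀ x) - c|
    rw [hε_def]
    linarith
  -- return times to `U` are syndetic: a return time in every window of length `L`
  obtain ⟨L, -, hwin⟩ := isSyndetic_iff_exists_window.1 (hx U (hUo.mem_nhds hxU))
  -- convergence threshold
  obtain ⟨N, hN⟩ := Metric.tendsto_atTop.1 hc ε hε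
  -- a return time `t ≥ N - s₀`
  obtain ⟨t, ht, htU⟩ := hwin (N - s₀)
  have h1 : ε < |φ (ϕ s₀ (ϕ t x)) - c| := htU
  rw [← hadd] at h1
  have h2 := hN (s₀ + t) (by linarith [ht.1])
  rw [Real.dist_eq] at h2
  exact lt_irrefl _ (h1.trans h2)

/-- **Convergent + recurrent ⇒ constant** (registered stub S1 of line `Ideator5Round2Sketch`, the
signature verbatim): for a jointly continuous `ℝ`-action `ϕ` with the action law and `ϕ 0 = id`, a
continuous observable `φ`, and a uniformly recurrent point `x`, if `φ (ϕ s x) → c` as `s → +∞` then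
`φ (ϕ s x) = c` for every `s : ℝ` (`const_of_tendsto_of_isUniformlyRecurrentPt`; the hypothesis
`ϕ 0 = id` is part of the registered signature but not needed). [folklore; cite: Furstenberg1981,
Ch. 1 §4 for the notions] -/
theorem stub_constOfTendstoOfRecurrent :
    ∀ {X : Type*} [TopologicalSpace X] (ϕ : ℝ → X → X), Continuous (fun p : ℝ × X => ϕ p.1 p.2) → (∀ s t y, ϕ (s + t) y = ϕ s (ϕ t y)) → (∀ y, ϕ 0 y = y) → ∀ (φ : X → ℝ), Continuous φ → ∀ (x : X), Literature.Dynamics.TopologicalDynamics.IsUniformlyRecurrentPt ϕ x → ∀ (c : ℝ), Filter.Tendsto (fun s => φ (ϕ s x)) Filter.atTop (nhds c) → ∀ s : ℝ, φ (ϕ s x) = c :=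
  fun ϕ hcont hadd _h0 _φ hφ _x hx _c hc s =>
    const_of_tendsto_of_isUniformlyRecurrentPt (ϕ := ϕ) hcont hadd hφ hx hc s

end Summit.NavierStokesRegularity.NavierStokesRegularity.Theorems

end
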